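import Mathlib.Analysis.InnerProductSpace.Calculus
import Mathlib.Analysis.InnerProductSpace.PiL2
import Mathlib.Analysis.SpecialFunctions.Exponential
import Mathlib.Analysis.Matrix.Normed
import Mathlib.Analysis.SpecialFunctions.ExpDeriv
import Mathlib.Analysis.Calculus.Deriv.MeanValue
import Mathlib.MeasureTheory.Integral.IntervalIntegral.FundThmCalculus
import HarnessLib

/-!
# First-order averaging for a linear dissipative system with a fast, large, mean-small perturbation
# (Sanders–Verhulst–Murdock, *Averaging Methods in Nonlinear Dynamical Systems*, Thm 2.8.1 with
# Besjes' Lemma 2.8.2, and Thm 5.5.1 (Eckhaus/Sanchez-Palencia) on `[0, ∞)` under attraction)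

Topic `Literature/Analysis/ODE` (namespace `Literature.Analysis.ODE.PeriodicAveraging`). Everything
here is PROVED (no named fact, no definition, no instance, no `sorry`).

THE SETTING. `E` is a real Hilbert space, `Ḡ : E →L[ℝ] E` is COERCIVE, `r_lo ‖v‖² ≤ ⟪Ḡ v, v⟫`
(no symmetry is needed), `g : ℝ → (E →L[ℝ] E)` is a continuous perturbation which is LARGE
pointwise, `‖g(s)‖ ≤ L` (typically `L ≈ ‖Ḡ‖`), but whose means over the consecutive windows
`[nP, (n+1)P]` are small, `‖∫_{nP}^{(n+1)P} g‖ ≤ η P`, and `x` solves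
`x' = -(Ḡ + g(t)) x` on `[0, t]`. We compare `x(t)` with the constant-coefficient flow
`exp(-tḠ) x(0)`.

THE ESTIMATE (`norm_sub_exp_apply_le`). If `‖x(s)‖ ≤ M` on `[0, t]`, then
`‖x(t) - exp(-tḠ) x(0)‖ ≤ M · [η (min(t, 1/r_lo) + P) + L P (1 + (2‖Ḡ‖ + L)/r_lo)]`.
So the deviation is `O(mean drift × min(t, relaxation time)) + O(L P)`, RELATIVE TO THE A PRIORI
BOUND `M`, uniformly in `t ≥ 0`. Corollaries: (i) without any a priori bound, the Grönwall bound
`M = e^{Lt} ‖x(0)‖` (`norm_le_exp_mul_norm`, `norm_sub_exp_apply_le_of_horizon`: the finite-horizon Theorem 2.8.1); (ii) under the smallness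
condition `η (1/r_lo + P) + L P (1 + (2‖Ḡ‖ + L)/r_lo) ≤ 1/2` the estimate BOOTSTRAPS the a priori
bound `‖x(s)‖ ≤ 2 ‖x(0)‖` for all `s ≥ 0` (`norm_le_two_mul_norm_of_small`,
`norm_sub_exp_apply_le_of_small`: averaging over the infinite interval under exponential
attraction); (iii) the coordinate form on `ℝ^m` with matrices, entrywise bounds `|g_{ij}| ≤ r̄`,
entrywise window means `|∫ g_{ij}| ≤ e r̄ P`, a symmetric `Ḡ` with `r_lo Σvᵢ² ≤ vᵀḠv ≤ r̄ Σvᵢ²`,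
`r̄ ≤ κ r_lo`, and the a priori bound `Σ xᵢ(t)² ≤ B² Σ xᵢ(0)²`:
`Σᵢ (xᵢ(t) - zᵢ(t))² ≤ (m (2 + (m + 2) κ) B (e min(1, r̄ t) + r̄ P))² Σᵢ xᵢ(0)²` for the solution
`z` of `z' = -Ḡ z`, `z(0) = x(0)` (`sum_sq_sub_le_of_apriori`).

THE PROOF is the linear case of the printed one. Duhamel: `x(t) - exp(-tḠ)x(0) =
-∫₀ᵗ exp(-(t-s)Ḡ) g(s) x(s) ds` (`sub_exp_apply_eq_neg_integral`). On each window `[a, b]`,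
`b - a ≤ P`, integrate by parts against the antiderivative `G_a(s) = ∫ₐˢ g` (Besjes' lemma
[SVM, Lemma 2.8.2]: "if `x` were constant, the result would be trivial … because the integral would
be periodic"): `∫ₐᵇ exp(-(t-s)Ḡ) g x = exp(-(t-b)Ḡ) G_a(b) x(b) - ∫ₐᵇ exp(-(t-s)Ḡ) [Ḡ G_a -
G_a (Ḡ + g)] x` (`integral_window_eq`), where the boundary term carries the WINDOW MEAN
(`‖G_a(b)‖ ≤ η P` on a full window) and the bulk term carries `‖G_a(s)‖ ≤ L P`; then sum over the
`⌊t/P⌋` full windows and the last partial one using the contraction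
`‖exp(-τḠ) v‖ ≤ e^{-r_lo τ} ‖v‖` (`norm_exp_neg_smul_apply_le`) and the geometric sum
`Σ_{k<N} e^{-r_lo k P} ≤ 1 + 1/(r_lo P)`. This is Thm 2.8.1's proof with the exponential weight
that Thm 5.5.1 (Eckhaus/Sanchez-Palencia: "`x(t) - z(t) = O(δ(ε))`, `0 ≤ t < ∞` … `O(ε)` in the
periodic case", for an averaged equation with an exponentially attracting equilibrium) adds; the
near-identity change of variables form of the same computation is Hale's Lemma V.3.2.

WHY THE A PRIORI BOUND (or smallness) IS NEEDED — two counterexamples to the estimate with `M`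
replaced by `‖x(0)‖` (recorded for the K1L `stub_cellLawV` plan, whose first typing of this lemma
omitted it). (1) `E = ℝ²`, `Ḡ = 1`, `P = 1`, `g ≡ [[-1,1],[1,-1]]` (so `L = ‖Ḡ‖`-sized, window
means of RELATIVE size `1`): `x(t) = eᵗ(1,-1)` solves `x' = -(Ḡ+g)x` and `‖x(t) - e^{-t}x(0)‖ → ∞`.
(2) Means EXACTLY zero but `L P = O(1)`: `Ḡ = r_lo·1`, `g` cycling through
`r̄[[-1,-1],[0,1]], r̄[[0,1],[-1,0]], r̄[[1,0],[1,-1]]` on the thirds of each window of length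
`P = 1/r̄`: the monodromy of `y' = -g y` has spectral radius `1.13304`, so `x = e^{-r_lo t} y` grows
as soon as `r̄ > 8.006 r_lo` (second-order Magnus terms of size `r̄ · r̄P` beat `r_lo`).

## Mathlib / tree search

Used: `hasDerivAt_exp_smul_const`, `HasDerivAt.clm_apply`, `HasDerivAt.norm_sq`,
`antitone_of_hasDerivAt_nonpos`, `Continuous.integral_hasStrictDerivAt`,
`intervalIntegral.integral_eq_sub_of_hasDerivAt_of_le`, `intervalIntegral.sum_integral_adjacent_intervals`,
`intervalIntegral.norm_integral_le_of_norm_le_const`, `EuclideanSpace` / `Matrix.toEuclideanLin`.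
Tree: `MatrixExpAveraging.lean` is the UNITARY-phase averaging estimate (commutator corrector,
`O(1/n)`), `SlowColumnSlaving*.lean` the Riccati slaving of one slow column, `FloquetGrowthExponent`
/ `PeriodicDissipative` growth and dissipativity of periodic systems — none gives the dissipative
first-order averaging bound relative to an a priori bound.

## References

* J. A. Sanders, F. Verhulst, J. Murdock, *Averaging Methods in Nonlinear Dynamical Systems*,
  2nd ed., Applied Mathematical Sciences 59, Springer (2007): Theorem 2.8.1 and Lemma 2.8.2 (Besjes)
  with their proofs (held: `book:sandersnd-averaging-methods-nonlinear-dynamical-systems`, PDF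
  pp. 68–69), Theorem 5.5.1 (Eckhaus/Sanchez-Palencia) with its proof (PDF pp. 127–128).
  [`SandersVerhulstMurdock2007`]
* J. K. Hale, *Ordinary Differential Equations*, 2nd ed., Krieger (1980), Ch. V §3, Lemma 3.2 and
  eq. (3.8)–(3.9) (held: `book:halend-ordinary-differential-equations`, PDF p. 188). [`Hale1980`]
-/

noncomputable section

open NormedSpace Set MeasureTheory intervalIntegral
open scoped InnerProductSpace

namespace Literature.Analysis.ODE.PeriodicAveraging

variable {E : Type*} [NormedAddCommGroup E] [InnerProductSpace ℝ E] [CompleteSpace E]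

/-! ## §1 The constant-coefficient flow `exp(-τḠ)`: derivative, contraction, uniqueness -/

/-- `d/dσ exp(-σḠ) = -(exp(-σḠ) Ḡ)` in the operator algebra. [folklore] -/
private theorem hasDerivAt_exp_neg_smul (G : E →L[ℝ] E) (σ : ℝ) :
    HasDerivAt (fun u : ℝ => exp (-(u • G))) (-(exp (-(σ • G)) * G)) σ := by
  have h := hasDerivAt_exp_smul_const (-G) σ
  simp only [smul_neg, mul_neg] at h
  exact h

/-- `d/ds exp(-(t-s)Ḡ) = exp(-(t-s)Ḡ) Ḡ`. [folklore] -/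
private theorem hasDerivAt_exp_neg_sub_smul (G : E →L[ℝ] E) (t s : ℝ) :
    HasDerivAt (fun u : ℝ => exp (-((t - u) • G))) (exp (-((t - s) • G)) * G) s := by
  have h := (hasDerivAt_exp_neg_smul G (t - s)).scomp s ((hasDerivAt_id s).const_sub t)
  simpa [Function.comp_def] using h

/-- `d/dσ [exp(-σḠ) v] = -Ḡ … ` applied form: the orbit `σ ↦ exp(-σḠ) v` solves `z' = -Ḡ z` in the
form `z' σ = -(exp(-σḠ) (Ḡ v))`… stated with the derivative `-(exp(-σḠ) Ḡ) v`. [folklore] -/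
private theorem hasDerivAt_exp_neg_smul_apply (G : E →L[ℝ] E) (v : E) (σ : ℝ) :
    HasDerivAt (fun u : ℝ => exp (-(u • G)) v) (-((exp (-(σ • G)) * G) v)) σ := by
  have h := (hasDerivAt_exp_neg_smul G σ).clm_apply (hasDerivAt_const σ v)
  simpa using h

omit [CompleteSpace E] in
/-- `Ḡ` commutes with `exp(-σḠ)`. [folklore] -/
private theorem exp_neg_smul_mul_comm (G : E →L[ℝ] E) (σ : ℝ) :
    exp (-(σ • G)) * G = G * exp (-(σ • G)) := by
  have hc : Commute (-(σ • G)) G := ((Commute.refl G).smul_left σ).neg_left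
  exact hc.exp_left.eq

/-- **Coercivity ⇒ contraction**: if `r_lo ‖v‖² ≤ ⟪Ḡ v, v⟫` for all `v`, then
`‖exp(-τḠ) v‖ ≤ e^{-r_lo τ} ‖v‖` for `τ ≥ 0` (energy identity `d/dτ ‖z‖² = -2⟪Ḡ z, z⟫`).
[cite: SandersVerhulstMurdock2007, Lemma 5.2.7 (linear case)] -/
theorem norm_exp_neg_smul_apply_le (G : E →L[ℝ] E) {rlo : ℝ}
    (hcoer : ∀ v : E, rlo * ‖v‖ ^ 2 ≤ ⟪G v, v⟫_ℝ) (v : E) {τ : ℝ} (hτ : 0 ≤ τ) :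
    ‖exp (-(τ • G)) v‖ ≤ Real.exp (-(rlo * τ)) * ‖v‖ := by
  set z : ℝ → E := fun u => exp (-(u • G)) v with hz
  -- φ(u) = e^{2 rlo u} ‖z u‖² is non-increasing
  set φ : ℝ → ℝ := fun u => Real.exp (2 * rlo * u) * ‖z u‖ ^ 2 with hφ
  have hzd : ∀ u, HasDerivAt z (-((exp (-(u • G)) * G) v)) u := fun u =>
    hasDerivAt_exp_neg_smul_apply G v u
  have hφd : ∀ u, HasDerivAt φ (Real.exp (2 * rlo * u) * (2 * rlo) * ‖z u‖ ^ 2 +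
      Real.exp (2 * rlo * u) * (2 * ⟪z u, -((exp (-(u • G)) * G) v)⟫_ℝ)) u := by
    intro u
    have h1 : HasDerivAt (fun u => Real.exp (2 * rlo * u)) (Real.exp (2 * rlo * u) * (2 * rlo)) u := by
      have := ((hasDerivAt_id u).const_mul (2 * rlo)).exp
      simpa using this
    exact h1.mul (hzd u).norm_sq
  have hφ' : ∀ u, Real.exp (2 * rlo * u) * (2 * rlo) * ‖z u‖ ^ 2 +
      Real.exp (2 * rlo * u) * (2 * ⟪z u, -((exp (-(u • G)) * G) v)⟫_ℝ) ≤ 0 := by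
    intro u
    have hGz : ((exp (-(u • G)) * G) v) = G (z u) := by
      rw [exp_neg_smul_mul_comm, mul_apply_eq_comp]
    rw [hGz, inner_neg_right, real_inner_comm]
    have hc := hcoer (z u)
    have hpos := Real.exp_pos (2 * rlo * u)
    nlinarith [hc, hpos]
  have hanti : Antitone φ := antitone_of_hasDerivAt_nonpos hφd hφ'
  have hφτ : φ τ ≤ φ 0 := hanti hτ
  have hφ0 : φ 0 = ‖v‖ ^ 2 := by simp [hφ, hz]
  rw [hφ0] at hφτ
  -- ‖z τ‖² ≤ e^{-2 rlo τ} ‖v‖²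
  have hexp : Real.exp (2 * rlo * τ) * Real.exp (-(rlo * τ)) ^ 2 = 1 := by
    rw [← Real.exp_nat_mul, ← Real.exp_add]; norm_num; ring_nf
  have hsq : ‖z τ‖ ^ 2 ≤ (Real.exp (-(rlo * τ)) * ‖v‖) ^ 2 := by
    have hpos := Real.exp_pos (2 * rlo * τ)
    have : Real.exp (2 * rlo * τ) * ‖z τ‖ ^ 2 ≤ Real.exp (2 * rlo * τ) *
        (Real.exp (-(rlo * τ)) * ‖v‖) ^ 2 := by
      calc Real.exp (2 * rlo * τ) * ‖z τ‖ ^ 2 = φ τ := rfl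
        _ ≤ ‖v‖ ^ 2 := hφτ
        _ = Real.exp (2 * rlo * τ) * (Real.exp (-(rlo * τ)) * ‖v‖) ^ 2 := by
          rw [mul_pow, ← mul_assoc, hexp, one_mul]
    exact le_of_mul_le_mul_left this hpos
  have hnn : 0 ≤ Real.exp (-(rlo * τ)) * ‖v‖ := mul_nonneg (Real.exp_pos _).le (norm_nonneg _)
  exact (pow_le_pow_iff_left₀ (norm_nonneg _) hnn two_ne_zero).1 hsq

/-- **Uniqueness / explicit form of the averaged flow**: a solution `z` of `z' = -Ḡ z` on `[0, t]`
is `z(t) = exp(-tḠ) z(0)` (variation of constants with zero forcing).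
[cite: Hale1980, Ch. III §1, Theorem 1.1 (homogeneous case)] -/
theorem eq_exp_neg_smul_apply (G : E →L[ℝ] E) (z : ℝ → E) {t : ℝ} (ht : 0 ≤ t)
    (hz : ∀ s ∈ Icc 0 t, HasDerivAt z (-(G (z s))) s) :
    z t = exp (-(t • G)) (z 0) := by
  -- F(s) = exp(-(t-s)Ḡ) (z s) has zero derivative on [0, t]
  set F : ℝ → E := fun s => exp (-((t - s) • G)) (z s) with hF
  have hFd : ∀ s ∈ Icc 0 t, HasDerivAt F 0 s := by
    intro s hs
    have h := (hasDerivAt_exp_neg_sub_smul G t s).clm_apply (hz s hs)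
    have h0 : (exp (-((t - s) • G)) * G) (z s) + (exp (-((t - s) • G))) (-(G (z s))) = 0 := by
      rw [mul_apply_eq_comp, map_neg, add_neg_cancel]
    rw [h0] at h
    exact h
  have hcont : ContinuousOn F (Icc 0 t) := fun s hs => (hFd s hs).continuousAt.continuousWithinAt
  have hint := integral_eq_sub_of_hasDerivAt_of_le ht hcont (fun s hs => hFd s (Ioo_subset_Icc_self hs))
    intervalIntegrable_const
  rw [intervalIntegral.integral_zero] at hint
  have hFt : F t = z t := by simp [hF, exp_zero]
  have hF0 : F 0 = exp (-(t • G)) (z 0) := by simp [hF]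
  rw [← hFt, ← hF0]
  exact (sub_eq_zero.1 hint.symm)

/-! ## §2 Duhamel's formula for `x' = -(Ḡ + g) x` against the flow `exp(-τḠ)` -/

/-- **Duhamel**: if `x' = -(Ḡ x + g(s) x)` on `[0, t]` (`g` continuous), then
`x(t) - exp(-tḠ) x(0) = -∫₀ᵗ exp(-(t-s)Ḡ) (g(s) x(s)) ds`.
[cite: SandersVerhulstMurdock2007, proof of Theorem 2.8.1 (the error integral `E(t, ε)`)] -/
theorem sub_exp_apply_eq_neg_integral (G : E →L[ℝ] E) {g : ℝ → E →L[ℝ] E} (hg : Continuous g)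
    (x : ℝ → E) {t : ℝ} (ht : 0 ≤ t)
    (hx : ∀ s ∈ Icc 0 t, HasDerivAt x (-(G (x s) + g s (x s))) s) :
    x t - exp (-(t • G)) (x 0) = -∫ s in (0 : ℝ)..t, exp (-((t - s) • G)) (g s (x s)) := by
  set F : ℝ → E := fun s => exp (-((t - s) • G)) (x s) with hF
  have hFd : ∀ s ∈ Icc 0 t, HasDerivAt F (-(exp (-((t - s) • G)) (g s (x s)))) s := by
    intro s hs
    have h := (hasDerivAt_exp_neg_sub_smul G t s).clm_apply (hx s hs)
    have h0 : (exp (-((t - s) • G)) * G) (x s) + (exp (-((t - s) • G))) (-(G (x s) + g s (x s))) =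
        -(exp (-((t - s) • G)) (g s (x s))) := by
      simp only [mul_apply_eq_comp, map_neg, map_add]; abel
    rw [h0] at h
    exact h
  have hxc : ContinuousOn x (Icc 0 t) := fun s hs => (hx s hs).continuousAt.continuousWithinAt
  have hcont : ContinuousOn F (Icc 0 t) := fun s hs => (hFd s hs).continuousAt.continuousWithinAt
  have hEc : Continuous fun s : ℝ => exp (-((t - s) • G)) :=
    continuous_iff_continuousAt.2 fun s => (hasDerivAt_exp_neg_sub_smul G t s).continuousAt
  have hic : ContinuousOn (fun s => -(exp (-((t - s) • G)) (g s (x s)))) (Icc 0 t) :=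
    (hEc.continuousOn.clm_apply (hg.continuousOn.clm_apply hxc)).neg
  have hint := integral_eq_sub_of_hasDerivAt_of_le ht hcont (fun s hs => hFd s (Ioo_subset_Icc_self hs))
    (hic.intervalIntegrable_of_Icc ht)
  have hFt : F t = x t := by simp [hF, exp_zero]
  have hF0 : F 0 = exp (-(t • G)) (x 0) := by simp [hF]
  rw [← hFt, ← hF0, ← hint, intervalIntegral.integral_neg]

/-! ## §3 One window: integration by parts against the antiderivative of `g` (Besjes' lemma) -/

/-- **One window, exact identity.** For `0 ≤ a ≤ b ≤ t` and `G_a(s) = ∫ₐˢ g`: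
`∫ₐᵇ exp(-(t-s)Ḡ) g(s) x(s) ds = exp(-(t-b)Ḡ) G_a(b) x(b)
  - ∫ₐᵇ exp(-(t-s)Ḡ) [Ḡ G_a(s) x(s) - G_a(s) (Ḡ x(s) + g(s) x(s))] ds`.
[cite: SandersVerhulstMurdock2007, Lemma 2.8.2 (Besjes), proof] -/
theorem integral_window_eq (G : E →L[ℝ] E) {g : ℝ → E →L[ℝ] E} (hg : Continuous g)
    (x : ℝ → E) {a b t : ℝ} (ha : 0 ≤ a) (hab : a ≤ b) (hbt : b ≤ t)
    (hx : ∀ s ∈ Icc 0 t, HasDerivAt x (-(G (x s) + g s (x s))) s) :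
    ∫ s in a..b, exp (-((t - s) • G)) (g s (x s)) =
      exp (-((t - b) • G)) ((∫ σ in a..b, g σ) (x b)) -
      ∫ s in a..b, exp (-((t - s) • G))
        (G ((∫ σ in a..s, g σ) (x s)) - (∫ σ in a..s, g σ) (G (x s) + g s (x s))) := by
  set Ga : ℝ → E →L[ℝ] E := fun s => ∫ σ in a..s, g σ with hGa
  have hGad : ∀ s, HasDerivAt Ga (g s) s := fun s => (hg.integral_hasStrictDerivAt a s).hasDerivAt
  set H : ℝ → E := fun s => exp (-((t - s) • G)) (Ga s (x s)) with hH
  have hxI : ∀ s ∈ Icc a b, HasDerivAt x (-(G (x s) + g s (x s))) s := fun s hs =>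
    hx s ⟨ha.trans hs.1, hs.2.trans hbt⟩
  -- H' = exp(-(t-s)Ḡ) [Ḡ Ga x + g x - Ga (Ḡ x + g x)]
  have hHd : ∀ s ∈ Icc a b, HasDerivAt H (exp (-((t - s) • G)) (g s (x s)) +
      exp (-((t - s) • G)) (G (Ga s (x s)) - Ga s (G (x s) + g s (x s)))) s := by
    intro s hs
    have h1 : HasDerivAt (fun u => Ga u (x u)) (g s (x s) + Ga s (-(G (x s) + g s (x s)))) s :=
      (hGad s).clm_apply (hxI s hs)
    have h := (hasDerivAt_exp_neg_sub_smul G t s).clm_apply h1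
    have h0 : (exp (-((t - s) • G)) * G) (Ga s (x s)) +
        exp (-((t - s) • G)) (g s (x s) + Ga s (-(G (x s) + g s (x s)))) =
        exp (-((t - s) • G)) (g s (x s)) +
          exp (-((t - s) • G)) (G (Ga s (x s)) - Ga s (G (x s) + g s (x s))) := by
      simp only [mul_apply_eq_comp, map_neg, map_add, map_sub]; abel
    rw [h0] at h
    exact h
  have hxc : ContinuousOn x (Icc a b) := fun s hs => (hxI s hs).continuousAt.continuousWithinAt
  have hHc : ContinuousOn H (Icc a b) := fun s hs => (hHd s hs).continuousAt.continuousWithinAt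
  have hEc : Continuous fun s : ℝ => exp (-((t - s) • G)) :=
    continuous_iff_continuousAt.2 fun s => (hasDerivAt_exp_neg_sub_smul G t s).continuousAt
  have hGac : Continuous Ga := continuous_iff_continuousAt.2 fun s => (hGad s).continuousAt
  have h1c : ContinuousOn (fun s => exp (-((t - s) • G)) (g s (x s))) (Icc a b) :=
    hEc.continuousOn.clm_apply (hg.continuousOn.clm_apply hxc)
  have h2c : ContinuousOn (fun s => exp (-((t - s) • G))
      (G (Ga s (x s)) - Ga s (G (x s) + g s (x s)))) (Icc a b) :=
    hEc.continuousOn.clm_apply ((continuous_const.continuousOn.clm_apply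
      (hGac.continuousOn.clm_apply hxc)).sub (hGac.continuousOn.clm_apply
        ((continuous_const.continuousOn.clm_apply hxc).add (hg.continuousOn.clm_apply hxc))))
  have hint := integral_eq_sub_of_hasDerivAt_of_le hab hHc (fun s hs => hHd s (Ioo_subset_Icc_self hs))
    ((h1c.add h2c).intervalIntegrable_of_Icc hab)
  rw [intervalIntegral.integral_add (h1c.intervalIntegrable_of_Icc hab)
    (h2c.intervalIntegrable_of_Icc hab)] at hint
  have hHa : H a = 0 := by simp [hH, hGa]
  have hHb : H b = exp (-((t - b) • G)) ((∫ σ in a..b, g σ) (x b)) := rfl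
  rw [hHa, sub_zero, hHb] at hint
  rw [← hint]; abel


/-- Continuity of `s ↦ exp(-(t-s)Ḡ)`. [folklore] -/
private theorem continuous_exp_neg_sub_smul (G : E →L[ℝ] E) (t : ℝ) :
    Continuous fun s : ℝ => exp (-((t - s) • G)) :=
  continuous_iff_continuousAt.2 fun s => (hasDerivAt_exp_neg_sub_smul G t s).continuousAt

/-- **One window, bound.** In the situation of `integral_window_eq`, with the contraction rate
`r_lo` of `Ḡ`, `‖Ḡ‖ ≤ Gn`, `‖g‖ ≤ L` and `‖x‖ ≤ M` on `[0, t]`, a window `[a, b] ⊆ [0, t]` of length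
`b - a ≤ P` and `‖∫ₐᵇ g‖ ≤ μ` contributes
`‖∫ₐᵇ exp(-(t-s)Ḡ) g x‖ ≤ e^{-r_lo (t-b)} μ M + L P (2 Gn + L) M ∫ₐᵇ e^{-r_lo (t-s)} ds`.
[cite: SandersVerhulstMurdock2007, Lemma 2.8.2 (Besjes) and proof of Theorem 5.5.1] -/
theorem norm_integral_window_le (G : E →L[ℝ] E) {g : ℝ → E →L[ℝ] E} (hg : Continuous g)
    (x : ℝ → E) {rlo Gn L M P μ a b t : ℝ} (ha : 0 ≤ a) (hab : a ≤ b) (hbt : b ≤ t)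
    (hbaP : b - a ≤ P)
    (hcoer : ∀ v : E, rlo * ‖v‖ ^ 2 ≤ ⟪G v, v⟫_ℝ) (hGn : ‖G‖ ≤ Gn)
    (hL : ∀ s ∈ Icc 0 t, ‖g s‖ ≤ L) (hμ : ‖∫ σ in a..b, g σ‖ ≤ μ)
    (hx : ∀ s ∈ Icc 0 t, HasDerivAt x (-(G (x s) + g s (x s))) s)
    (hM : ∀ s ∈ Icc 0 t, ‖x s‖ ≤ M) :
    ‖∫ s in a..b, exp (-((t - s) • G)) (g s (x s))‖ ≤
      Real.exp (-(rlo * (t - b))) * μ * M +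
        L * P * (2 * Gn + L) * M * ∫ s in a..b, Real.exp (-(rlo * (t - s))) := by
  have hbI : b ∈ Icc 0 t := ⟨ha.trans hab, hbt⟩
  have hM0 : 0 ≤ M := (norm_nonneg _).trans (hM b hbI)
  have hL0 : 0 ≤ L := (norm_nonneg _).trans (hL b hbI)
  have hGn0 : 0 ≤ Gn := (norm_nonneg _).trans hGn
  have hP0 : 0 ≤ P := (sub_nonneg.2 hab).trans hbaP
  rw [integral_window_eq G hg x ha hab hbt hx]
  -- antiderivative bound ‖∫ₐˢ g‖ ≤ L P on [a, b]
  have hGa : ∀ s ∈ Icc a b, ‖∫ σ in a..s, g σ‖ ≤ L * P := by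
    intro s hs
    have h1 : ‖∫ σ in a..s, g σ‖ ≤ L * |s - a| := by
      refine norm_integral_le_of_norm_le_const fun σ hσ => hL σ ?_
      rw [uIoc_of_le hs.1] at hσ
      exact ⟨ha.trans hσ.1.le, (hσ.2.trans hs.2).trans hbt⟩
    rw [abs_of_nonneg (sub_nonneg.2 hs.1)] at h1
    exact h1.trans (mul_le_mul_of_nonneg_left ((sub_le_sub_right hs.2 a).trans hbaP) hL0)
  -- boundary term
  have hbd : ‖exp (-((t - b) • G)) ((∫ σ in a..b, g σ) (x b))‖ ≤ Real.exp (-(rlo * (t - b))) * μ * M := by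
    refine (norm_exp_neg_smul_apply_le G hcoer _ (sub_nonneg.2 hbt)).trans ?_
    rw [mul_assoc]
    refine mul_le_mul_of_nonneg_left ?_ (Real.exp_pos _).le
    exact (ContinuousLinearMap.le_opNorm _ _).trans (mul_le_mul hμ (hM b hbI) (norm_nonneg _)
      ((norm_nonneg _).trans hμ))
  -- bulk term
  have hxc : ContinuousOn x (Icc 0 t) := fun s hs => (hx s hs).continuousAt.continuousWithinAt
  have hbulk : ‖∫ s in a..b, exp (-((t - s) • G))
      (G ((∫ σ in a..s, g σ) (x s)) - (∫ σ in a..s, g σ) (G (x s) + g s (x s)))‖ ≤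
      ∫ s in a..b, L * P * (2 * Gn + L) * M * Real.exp (-(rlo * (t - s))) := by
    refine norm_integral_le_of_norm_le hab (Filter.Eventually.of_forall fun s hs => ?_) ?_
    · have hs' : s ∈ Icc a b := ⟨hs.1.le, hs.2⟩
      have hsI : s ∈ Icc 0 t := ⟨ha.trans hs.1.le, hs.2.trans hbt⟩
      refine (norm_exp_neg_smul_apply_le G hcoer _ (sub_nonneg.2 hsI.2)).trans ?_
      have hGas := hGa s hs'
      have hxs := hM s hsI
      have hgs := hL s hsI
      have h1 : ‖G ((∫ σ in a..s, g σ) (x s))‖ ≤ Gn * (L * P * M) :=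
        (G.le_opNorm _).trans (mul_le_mul hGn (((∫ σ in a..s, g σ).le_opNorm _).trans
          (mul_le_mul hGas hxs (norm_nonneg _) (mul_nonneg hL0 hP0))) (norm_nonneg _) hGn0)
      have h2 : ‖(∫ σ in a..s, g σ) (G (x s) + g s (x s))‖ ≤ L * P * ((Gn + L) * M) := by
        refine ((∫ σ in a..s, g σ).le_opNorm _).trans (mul_le_mul hGas ?_ (norm_nonneg _)
          (mul_nonneg hL0 hP0))
        refine (norm_add_le _ _).trans ?_
        rw [add_mul]
        exact add_le_add ((G.le_opNorm _).trans (mul_le_mul hGn hxs (norm_nonneg _) hGn0))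
          (((g s).le_opNorm _).trans (mul_le_mul hgs hxs (norm_nonneg _) hL0))
      have h3 : ‖G ((∫ σ in a..s, g σ) (x s)) - (∫ σ in a..s, g σ) (G (x s) + g s (x s))‖ ≤
          L * P * (2 * Gn + L) * M := by
        refine (norm_sub_le _ _).trans ?_
        nlinarith [h1, h2]
      calc Real.exp (-(rlo * (t - s))) *
            ‖G ((∫ σ in a..s, g σ) (x s)) - (∫ σ in a..s, g σ) (G (x s) + g s (x s))‖
          ≤ Real.exp (-(rlo * (t - s))) * (L * P * (2 * Gn + L) * M) :=
            mul_le_mul_of_nonneg_left h3 (Real.exp_pos _).le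
        _ = L * P * (2 * Gn + L) * M * Real.exp (-(rlo * (t - s))) := by ring
    · exact (continuous_const.mul ((continuous_const.mul
        (continuous_const.sub continuous_id)).neg.rexp)).intervalIntegrable _ _
  rw [intervalIntegral.integral_const_mul] at hbulk
  exact (norm_sub_le _ _).trans (add_le_add hbd hbulk)


/-! ## §4 Summation over the windows: the averaging estimate relative to an a priori bound -/

/-- Geometric sum of the contraction factors at the window ends: for `N P ≤ t`,
`Σ_{k<N} e^{-r_lo (t - (k+1)P)} ≤ 1 + 1/(r_lo P)`. [folklore] -/
private theorem sum_exp_neg_le {rlo P t : ℝ} (hrlo : 0 < rlo) (hP : 0 < P) (N : ℕ) (hN : (N : ℝ) * P ≤ t) :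
    ∑ k ∈ Finset.range N, Real.exp (-(rlo * (t - ((k : ℝ) + 1) * P))) ≤ 1 + 1 / (rlo * P) := by
  set q : ℝ := Real.exp (-(rlo * P)) with hq
  have hq0 : 0 ≤ q := (Real.exp_pos _).le
  have hq1 : q < 1 := Real.exp_lt_one_iff.2 (by nlinarith)
  -- termwise: e^{-rlo (t - (k+1)P)} ≤ q^(N-1-k)
  have hterm : ∀ k ∈ Finset.range N,
      Real.exp (-(rlo * (t - ((k : ℝ) + 1) * P))) ≤ q ^ (N - 1 - k) := by
    intro k hk
    rw [Finset.mem_range] at hk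
    rw [hq, ← Real.exp_nat_mul, Real.exp_le_exp]
    have hcast : ((N - 1 - k : ℕ) : ℝ) = (N : ℝ) - 1 - k := by
      rw [Nat.cast_sub (by omega), Nat.cast_sub (by omega)]; simp
    rw [hcast]
    nlinarith
  calc ∑ k ∈ Finset.range N, Real.exp (-(rlo * (t - ((k : ℝ) + 1) * P)))
      ≤ ∑ k ∈ Finset.range N, q ^ (N - 1 - k) := Finset.sum_le_sum hterm
    _ = ∑ k ∈ Finset.range N, q ^ k := Finset.sum_range_reflect (fun k => q ^ k) N
    _ ≤ ∑' k, q ^ k := (summable_geometric_of_lt_one hq0 hq1).sum_le_tsum _ (fun k _ => pow_nonneg hq0 k)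
    _ = (1 - q)⁻¹ := tsum_geometric_of_lt_one hq0 hq1
    _ ≤ (1 - 1 / (1 + rlo * P))⁻¹ := by
        have hq' : q ≤ 1 / (1 + rlo * P) := by
          rw [hq, Real.exp_neg, ← one_div]
          exact one_div_le_one_div_of_le (by positivity) (by linarith [Real.add_one_le_exp (rlo * P)])
        have hpos : 0 < 1 - 1 / (1 + rlo * P) := by
          rw [sub_pos, div_lt_one (by positivity)]; nlinarith
        exact inv_anti₀ hpos (sub_le_sub_left hq' 1)
    _ = 1 + 1 / (rlo * P) := by field_simp; ring

/-- The trivial bound: `Σ_{k<N} e^{-r_lo (t - (k+1)P)} ≤ N` for `N P ≤ t`. [folklore] -/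
private theorem sum_exp_neg_le_card {rlo P t : ℝ} (hrlo : 0 < rlo) (N : ℕ) (hN : (N : ℝ) * P ≤ t)
    (hP : 0 < P) :
    ∑ k ∈ Finset.range N, Real.exp (-(rlo * (t - ((k : ℝ) + 1) * P))) ≤ N := by
  have hterm : ∀ k ∈ Finset.range N, Real.exp (-(rlo * (t - ((k : ℝ) + 1) * P))) ≤ 1 := by
    intro k hk
    rw [Finset.mem_range] at hk
    rw [Real.exp_le_one_iff]
    have hk1 : ((k : ℝ) + 1) * P ≤ t := by
      have : ((k : ℝ) + 1) ≤ N := by exact_mod_cast hk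
      nlinarith
    nlinarith
  calc ∑ k ∈ Finset.range N, Real.exp (-(rlo * (t - ((k : ℝ) + 1) * P)))
      ≤ ∑ _k ∈ Finset.range N, (1 : ℝ) := Finset.sum_le_sum hterm
    _ = N := by simp

/-- `∫ₐᵇ e^{-r_lo (t - s)} ds = (e^{-r_lo (t-b)} - e^{-r_lo (t-a)}) / r_lo`. [folklore] -/
private theorem integral_exp_neg_sub (rlo t a b : ℝ) (hrlo : rlo ≠ 0) :
    ∫ s in a..b, Real.exp (-(rlo * (t - s))) =
      (Real.exp (-(rlo * (t - b))) - Real.exp (-(rlo * (t - a)))) / rlo := by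
  have hd : ∀ s, HasDerivAt (fun u => Real.exp (-(rlo * (t - u))) / rlo) (Real.exp (-(rlo * (t - s)))) s := by
    intro s
    have h := ((((hasDerivAt_id s).const_sub t).const_mul rlo).neg.exp).div_const rlo
    field_simp at h
    simpa using h
  rw [integral_eq_sub_of_hasDerivAt (fun s _ => hd s)
    ((continuous_const.mul (continuous_const.sub continuous_id)).neg.rexp.intervalIntegrable _ _)]
  ring

/-- **THE AVERAGING ESTIMATE (relative to an a priori bound).** Let `Ḡ` be coercive with rate
`r_lo > 0` and `‖Ḡ‖ ≤ Gn`; let `g` be continuous with `‖g(s)‖ ≤ L` on `[0, t]` and window means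
`‖∫_{nP}^{(n+1)P} g‖ ≤ η P` for every full window inside `[0, t]` (`P > 0`, `η ≥ 0`); let `x`
solve `x' = -(Ḡ x + g x)` on `[0, t]` with `‖x(s)‖ ≤ M` there. Then
`‖x(t) - exp(-tḠ) x(0)‖ ≤ M (η (min(t, 1/r_lo) + P) + L P (1 + (2 Gn + L)/r_lo))`.
[cite: SandersVerhulstMurdock2007, Theorem 2.8.1 (periodic averaging, `O(ε)`) and Theorem 5.5.1
(Eckhaus/Sanchez-Palencia, the `O(ε)` estimate on `0 ≤ t < ∞` under attraction), linear case] -/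
theorem norm_sub_exp_apply_le (G : E →L[ℝ] E) {g : ℝ → E →L[ℝ] E} (hg : Continuous g)
    (x : ℝ → E) {rlo Gn L η P M t : ℝ} (hrlo : 0 < rlo) (hP : 0 < P) (hη : 0 ≤ η) (ht : 0 ≤ t)
    (hcoer : ∀ v : E, rlo * ‖v‖ ^ 2 ≤ ⟪G v, v⟫_ℝ) (hGn : ‖G‖ ≤ Gn)
    (hL : ∀ s ∈ Icc 0 t, ‖g s‖ ≤ L)
    (hmean : ∀ n : ℕ, ((n : ℝ) + 1) * P ≤ t →
      ‖∫ s in ((n : ℝ) * P)..(((n : ℝ) + 1) * P), g s‖ ≤ η * P)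
    (hx : ∀ s ∈ Icc 0 t, HasDerivAt x (-(G (x s) + g s (x s))) s)
    (hM : ∀ s ∈ Icc 0 t, ‖x s‖ ≤ M) :
    ‖x t - exp (-(t • G)) (x 0)‖ ≤
      M * (η * (min t (1 / rlo) + P) + L * P * (1 + (2 * Gn + L) / rlo)) := by
  have h0I : (0 : ℝ) ∈ Icc 0 t := ⟨le_rfl, ht⟩
  have hM0 : 0 ≤ M := (norm_nonneg _).trans (hM 0 h0I)
  have hL0 : 0 ≤ L := (norm_nonneg _).trans (hL 0 h0I)
  have hGn0 : 0 ≤ Gn := (norm_nonneg _).trans hGn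
  set K : ℝ := L * P * (2 * Gn + L) * M with hK
  have hK0 : 0 ≤ K := by positivity
  -- the windows
  set N : ℕ := ⌊t / P⌋₊ with hN
  have hNP : (N : ℝ) * P ≤ t := by
    have := Nat.floor_le (div_nonneg ht hP.le); rw [← hN] at this
    exact (le_div_iff₀ hP).1 this
  have htNP : t - N * P ≤ P := by
    have := Nat.lt_floor_add_one (t / P); rw [← hN] at this
    have := (div_lt_iff₀ hP).1 this
    linarith
  -- the integrand and its integrability on sub-intervals of [0, t]
  set f : ℝ → E := fun s => exp (-((t - s) • G)) (g s (x s)) with hf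
  have hxc : ContinuousOn x (Icc 0 t) := fun s hs => (hx s hs).continuousAt.continuousWithinAt
  have hfc : ContinuousOn f (Icc 0 t) :=
    (continuous_exp_neg_sub_smul G t).continuousOn.clm_apply (hg.continuousOn.clm_apply hxc)
  have hfi : ∀ a b, 0 ≤ a → a ≤ b → b ≤ t → IntervalIntegrable f volume a b := fun a b ha hab hbt =>
    (hfc.mono (Icc_subset_Icc ha hbt)).intervalIntegrable_of_Icc hab
  -- Duhamel and the decomposition ∫₀ᵗ = Σ_{k<N} ∫_{kP}^{(k+1)P} + ∫_{NP}^t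
  rw [sub_exp_apply_eq_neg_integral G hg x ht hx, norm_neg]
  have hsplit : ∫ s in (0 : ℝ)..t, f s =
      (∑ k ∈ Finset.range N, ∫ s in ((k : ℝ) * P)..(((k : ℝ) + 1) * P), f s) +
        ∫ s in ((N : ℝ) * P)..t, f s := by
    have hadj := sum_integral_adjacent_intervals (μ := volume) (f := f) (a := fun k : ℕ => (k : ℝ) * P)
      (n := N) (fun k hk => hfi _ _ (by positivity) (by push_cast; nlinarith)
        (le_trans (by push_cast; nlinarith [show ((k : ℝ) + 1) ≤ N by exact_mod_cast hk]) hNP))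
    simp only [Nat.cast_zero, zero_mul] at hadj
    push_cast at hadj ⊢
    rw [hadj]
    exact (integral_add_adjacent_intervals (hfi _ _ le_rfl (by positivity) hNP)
      (hfi _ _ (by positivity) hNP le_rfl)).symm
  change ‖∫ s in (0 : ℝ)..t, f s‖ ≤ _
  rw [hsplit]
  -- window bounds
  have hwin : ∀ k ∈ Finset.range N, ‖∫ s in ((k : ℝ) * P)..(((k : ℝ) + 1) * P), f s‖ ≤
      Real.exp (-(rlo * (t - ((k : ℝ) + 1) * P))) * (η * P) * M +
        K * ∫ s in ((k : ℝ) * P)..(((k : ℝ) + 1) * P), Real.exp (-(rlo * (t - s))) := by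
    intro k hk
    rw [Finset.mem_range] at hk
    have hk1 : ((k : ℝ) + 1) * P ≤ t :=
      le_trans (by nlinarith [show ((k : ℝ) + 1) ≤ N by exact_mod_cast hk]) hNP
    exact norm_integral_window_le G hg x (by positivity) (by nlinarith) hk1 (by ring_nf; rfl)
      hcoer hGn hL (hmean k hk1) hx hM
  have hlast : ‖∫ s in ((N : ℝ) * P)..t, f s‖ ≤
      Real.exp (-(rlo * (t - t))) * (L * P) * M +
        K * ∫ s in ((N : ℝ) * P)..t, Real.exp (-(rlo * (t - s))) := by
    refine norm_integral_window_le G hg x (by positivity) hNP le_rfl htNP hcoer hGn hL ?_ hx hM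
    have h1 : ‖∫ σ in ((N : ℝ) * P)..t, g σ‖ ≤ L * |t - N * P| :=
      norm_integral_le_of_norm_le_const fun σ hσ => hL σ (by
        rw [uIoc_of_le hNP] at hσ; exact ⟨le_trans (by positivity) hσ.1.le, hσ.2⟩)
    rw [abs_of_nonneg (sub_nonneg.2 hNP)] at h1
    exact h1.trans (mul_le_mul_of_nonneg_left htNP hL0)
  -- sum of the exponential integrals = ∫₀ᵗ ≤ 1/rlo
  have hei : ∀ a b : ℝ, IntervalIntegrable (fun s => Real.exp (-(rlo * (t - s)))) volume a b :=
    fun a b => (continuous_const.mul (continuous_const.sub continuous_id)).neg.rexp.intervalIntegrable _ _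
  have hesum : (∑ k ∈ Finset.range N, ∫ s in ((k : ℝ) * P)..(((k : ℝ) + 1) * P),
      Real.exp (-(rlo * (t - s)))) + ∫ s in ((N : ℝ) * P)..t, Real.exp (-(rlo * (t - s))) =
      ∫ s in (0 : ℝ)..t, Real.exp (-(rlo * (t - s))) := by
    have hadj := sum_integral_adjacent_intervals (μ := volume)
      (f := fun s => Real.exp (-(rlo * (t - s)))) (a := fun k : ℕ => (k : ℝ) * P) (n := N)
      (fun k _ => hei _ _)
    simp only [Nat.cast_zero, zero_mul] at hadj
    push_cast at hadj ⊢
    rw [hadj]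
    exact integral_add_adjacent_intervals (hei _ _) (hei _ _)
  have heint : ∫ s in (0 : ℝ)..t, Real.exp (-(rlo * (t - s))) ≤ 1 / rlo := by
    rw [integral_exp_neg_sub rlo t 0 t hrlo.ne']
    refine div_le_div_of_nonneg_right ?_ hrlo.le
    simp only [sub_self, mul_zero, neg_zero, Real.exp_zero, sub_zero]
    linarith [Real.exp_pos (-(rlo * t))]
  -- the geometric sum of boundary factors
  have hS1 := sum_exp_neg_le hrlo hP N hNP
  have hS2 := sum_exp_neg_le_card hrlo N hNP hP
  have hSmin : (∑ k ∈ Finset.range N, Real.exp (-(rlo * (t - ((k : ℝ) + 1) * P)))) * (η * P) * M ≤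
      M * (η * (min t (1 / rlo) + P)) := by
    have h1 : P * (∑ k ∈ Finset.range N, Real.exp (-(rlo * (t - ((k : ℝ) + 1) * P)))) ≤
        P + 1 / rlo := by
      calc P * (∑ k ∈ Finset.range N, Real.exp (-(rlo * (t - ((k : ℝ) + 1) * P))))
          ≤ P * (1 + 1 / (rlo * P)) := mul_le_mul_of_nonneg_left hS1 hP.le
        _ = P + 1 / rlo := by field_simp
    have h2 : P * (∑ k ∈ Finset.range N, Real.exp (-(rlo * (t - ((k : ℝ) + 1) * P)))) ≤ t := by
      nlinarith
    have h3 : P * (∑ k ∈ Finset.range N, Real.exp (-(rlo * (t - ((k : ℝ) + 1) * P)))) ≤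
        min t (1 / rlo) + P := by
      rcases le_total t (1 / rlo) with h | h
      · rw [min_eq_left h]; linarith
      · rw [min_eq_right h]; linarith
    calc (∑ k ∈ Finset.range N, Real.exp (-(rlo * (t - ((k : ℝ) + 1) * P)))) * (η * P) * M
        = (η * M) * (P * ∑ k ∈ Finset.range N, Real.exp (-(rlo * (t - ((k : ℝ) + 1) * P)))) := by
          ring
      _ ≤ (η * M) * (min t (1 / rlo) + P) := mul_le_mul_of_nonneg_left h3 (mul_nonneg hη hM0)
      _ = M * (η * (min t (1 / rlo) + P)) := by ring
  have hA : (∑ k ∈ Finset.range N, (Real.exp (-(rlo * (t - ((k : ℝ) + 1) * P))) * (η * P) * M +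
      K * ∫ s in ((k : ℝ) * P)..(((k : ℝ) + 1) * P), Real.exp (-(rlo * (t - s))))) =
      (∑ k ∈ Finset.range N, Real.exp (-(rlo * (t - ((k : ℝ) + 1) * P)))) * (η * P) * M +
        K * ∑ k ∈ Finset.range N, ∫ s in ((k : ℝ) * P)..(((k : ℝ) + 1) * P),
          Real.exp (-(rlo * (t - s))) := by
    rw [Finset.sum_add_distrib, Finset.sum_mul, Finset.sum_mul, Finset.mul_sum]
  -- assemble
  calc ‖(∑ k ∈ Finset.range N, ∫ s in ((k : ℝ) * P)..(((k : ℝ) + 1) * P), f s) +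
          ∫ s in ((N : ℝ) * P)..t, f s‖
      ≤ (∑ k ∈ Finset.range N, ‖∫ s in ((k : ℝ) * P)..(((k : ℝ) + 1) * P), f s‖) +
          ‖∫ s in ((N : ℝ) * P)..t, f s‖ := (norm_add_le _ _).trans
            (add_le_add (norm_sum_le _ _) le_rfl)
    _ ≤ (∑ k ∈ Finset.range N, (Real.exp (-(rlo * (t - ((k : ℝ) + 1) * P))) * (η * P) * M +
          K * ∫ s in ((k : ℝ) * P)..(((k : ℝ) + 1) * P), Real.exp (-(rlo * (t - s))))) +
          (Real.exp (-(rlo * (t - t))) * (L * P) * M +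
            K * ∫ s in ((N : ℝ) * P)..t, Real.exp (-(rlo * (t - s)))) :=
        add_le_add (Finset.sum_le_sum hwin) hlast
    _ = (∑ k ∈ Finset.range N, Real.exp (-(rlo * (t - ((k : ℝ) + 1) * P)))) * (η * P) * M +
          L * P * M + K * ((∑ k ∈ Finset.range N,
          ∫ s in ((k : ℝ) * P)..(((k : ℝ) + 1) * P), Real.exp (-(rlo * (t - s)))) +
            ∫ s in ((N : ℝ) * P)..t, Real.exp (-(rlo * (t - s)))) := by
        rw [hA]
        simp only [sub_self, mul_zero, neg_zero, Real.exp_zero, one_mul]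
        ring
    _ ≤ M * (η * (min t (1 / rlo) + P)) + L * P * M + K * (1 / rlo) := by
        rw [hesum]
        exact add_le_add (add_le_add hSmin le_rfl) (mul_le_mul_of_nonneg_left heint hK0)
    _ = M * (η * (min t (1 / rlo) + P) + L * P * (1 + (2 * Gn + L) / rlo)) := by
        rw [hK]; field_simp; ring

/-! ## §5 Corollaries: comparison with any solution of the averaged system; the bootstrap -/

/-- The averaging estimate against ANY solution `z` of the constant-coefficient system `z' = -Ḡ z`
with `z(0) = x(0)` (by uniqueness `z(t) = exp(-tḠ) x(0)`).
[cite: SandersVerhulstMurdock2007, Theorem 2.8.1 / Theorem 5.5.1, linear case] -/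
theorem norm_sub_le_of_apriori (G : E →L[ℝ] E) {g : ℝ → E →L[ℝ] E} (hg : Continuous g)
    (x z : ℝ → E) {rlo Gn L η P M t : ℝ} (hrlo : 0 < rlo) (hP : 0 < P) (hη : 0 ≤ η) (ht : 0 ≤ t)
    (hcoer : ∀ v : E, rlo * ‖v‖ ^ 2 ≤ ⟪G v, v⟫_ℝ) (hGn : ‖G‖ ≤ Gn)
    (hL : ∀ s ∈ Icc 0 t, ‖g s‖ ≤ L)
    (hmean : ∀ n : ℕ, ((n : ℝ) + 1) * P ≤ t →
      ‖∫ s in ((n : ℝ) * P)..(((n : ℝ) + 1) * P), g s‖ ≤ η * P)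
    (hx : ∀ s ∈ Icc 0 t, HasDerivAt x (-(G (x s) + g s (x s))) s)
    (hz : ∀ s ∈ Icc 0 t, HasDerivAt z (-(G (z s))) s) (hz0 : z 0 = x 0)
    (hM : ∀ s ∈ Icc 0 t, ‖x s‖ ≤ M) :
    ‖x t - z t‖ ≤ M * (η * (min t (1 / rlo) + P) + L * P * (1 + (2 * Gn + L) / rlo)) := by
  rw [eq_exp_neg_smul_apply G z ht hz, hz0]
  exact norm_sub_exp_apply_le G hg x hrlo hP hη ht hcoer hGn hL hmean hx hM

/-- **Bootstrap of the a priori bound (averaging on `[0, ∞)` under attraction).** If the data are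
global (`‖g‖ ≤ L` and the window-mean bound on all of `[0, ∞)`, `x` a global solution) and SMALL,
`η (1/r_lo + P) + L P (1 + (2 Gn + L)/r_lo) ≤ 1/2`, then `‖x(t)‖ ≤ 2 ‖x(0)‖` for all `t ≥ 0`.
[cite: SandersVerhulstMurdock2007, Theorem 5.5.1 (Eckhaus/Sanchez-Palencia), linear case] -/
theorem norm_le_two_mul_norm_of_small (G : E →L[ℝ] E) {g : ℝ → E →L[ℝ] E} (hg : Continuous g)
    (x : ℝ → E) {rlo Gn L η P : ℝ} (hrlo : 0 < rlo) (hP : 0 < P) (hη : 0 ≤ η)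
    (hcoer : ∀ v : E, rlo * ‖v‖ ^ 2 ≤ ⟪G v, v⟫_ℝ) (hGn : ‖G‖ ≤ Gn)
    (hL : ∀ s, 0 ≤ s → ‖g s‖ ≤ L)
    (hmean : ∀ n : ℕ, ‖∫ s in ((n : ℝ) * P)..(((n : ℝ) + 1) * P), g s‖ ≤ η * P)
    (hx : ∀ s, 0 ≤ s → HasDerivAt x (-(G (x s) + g s (x s))) s)
    (hsmall : η * (1 / rlo + P) + L * P * (1 + (2 * Gn + L) / rlo) ≤ 1 / 2) :
    ∀ t, 0 ≤ t → ‖x t‖ ≤ 2 * ‖x 0‖ := by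
  intro t ht
  -- the maximum of ‖x‖ on [0, t]
  have hxc : ContinuousOn (fun s => ‖x s‖) (Icc 0 t) := fun s hs =>
    ((hx s hs.1).continuousAt.norm).continuousWithinAt
  obtain ⟨s₀, hs₀, hmax⟩ := (isCompact_Icc (a := (0 : ℝ)) (b := t)).exists_isMaxOn
    (nonempty_Icc.2 ht) hxc
  have hmax' : ∀ s ∈ Icc 0 t, ‖x s‖ ≤ ‖x s₀‖ := fun s hs => hmax hs
  -- the estimate at time s₀ with M = ‖x s₀‖
  have hest := norm_sub_exp_apply_le G hg x hrlo hP hη hs₀.1 hcoer hGn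
    (fun s hs => hL s hs.1) (fun n _ => hmean n) (fun s hs => hx s hs.1)
    (fun s hs => hmax' s ⟨hs.1, hs.2.trans hs₀.2⟩)
  have hδ : η * (min s₀ (1 / rlo) + P) + L * P * (1 + (2 * Gn + L) / rlo) ≤ 1 / 2 := by
    have : min s₀ (1 / rlo) ≤ 1 / rlo := min_le_right _ _
    nlinarith
  have hflow : ‖exp (-(s₀ • G)) (x 0)‖ ≤ ‖x 0‖ := by
    refine (norm_exp_neg_smul_apply_le G hcoer (x 0) hs₀.1).trans ?_
    have : Real.exp (-(rlo * s₀)) ≤ 1 := Real.exp_le_one_iff.2 (by nlinarith [hs₀.1])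
    exact (mul_le_mul_of_nonneg_right this (norm_nonneg _)).trans (by rw [one_mul])
  have h1 : ‖x s₀‖ ≤ ‖x 0‖ + ‖x s₀‖ * (1 / 2) := by
    have htri : ‖x s₀‖ ≤ ‖exp (-(s₀ • G)) (x 0)‖ + ‖x s₀ - exp (-(s₀ • G)) (x 0)‖ := by
      have := norm_sub_norm_le (x s₀) (exp (-(s₀ • G)) (x 0)); linarith
    exact htri.trans (add_le_add hflow (hest.trans (mul_le_mul_of_nonneg_left hδ (norm_nonneg _))))
  have h2 : ‖x s₀‖ ≤ 2 * ‖x 0‖ := by linarith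
  exact (hmax' t ⟨ht, le_rfl⟩).trans h2

/-- **Averaging over the infinite interval under attraction** (Eckhaus/Sanchez-Palencia, linear
case): under the smallness condition of `norm_le_two_mul_norm_of_small`,
`‖x(t) - exp(-tḠ) x(0)‖ ≤ 2 ‖x(0)‖ (η (min(t, 1/r_lo) + P) + L P (1 + (2 Gn + L)/r_lo))` for all
`t ≥ 0`. [cite: SandersVerhulstMurdock2007, Theorem 5.5.1] -/
theorem norm_sub_exp_apply_le_of_small (G : E →L[ℝ] E) {g : ℝ → E →L[ℝ] E} (hg : Continuous g)
    (x : ℝ → E) {rlo Gn L η P : ℝ} (hrlo : 0 < rlo) (hP : 0 < P) (hη : 0 ≤ η)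
    (hcoer : ∀ v : E, rlo * ‖v‖ ^ 2 ≤ ⟪G v, v⟫_ℝ) (hGn : ‖G‖ ≤ Gn)
    (hL : ∀ s, 0 ≤ s → ‖g s‖ ≤ L)
    (hmean : ∀ n : ℕ, ‖∫ s in ((n : ℝ) * P)..(((n : ℝ) + 1) * P), g s‖ ≤ η * P)
    (hx : ∀ s, 0 ≤ s → HasDerivAt x (-(G (x s) + g s (x s))) s)
    (hsmall : η * (1 / rlo + P) + L * P * (1 + (2 * Gn + L) / rlo) ≤ 1 / 2) {t : ℝ} (ht : 0 ≤ t) :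
    ‖x t - exp (-(t • G)) (x 0)‖ ≤
      2 * ‖x 0‖ * (η * (min t (1 / rlo) + P) + L * P * (1 + (2 * Gn + L) / rlo)) :=
  norm_sub_exp_apply_le G hg x hrlo hP hη ht hcoer hGn (fun s hs => hL s hs.1) (fun n _ => hmean n)
    (fun s hs => hx s hs.1)
    (fun s hs => norm_le_two_mul_norm_of_small G hg x hrlo hP hη hcoer hGn hL hmean hx hsmall s hs.1)


omit [CompleteSpace E] in
/-- **Energy (Grönwall) bound on a finite horizon**: for a coercive `Ḡ` (rate `r_lo ≥ 0`) and
`‖g‖ ≤ L` on `[0, t]`, every solution of `x' = -(Ḡ x + g x)` has `‖x(s)‖ ≤ e^{L s} ‖x(0)‖` on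
`[0, t]` (`d/ds ‖x‖² = -2⟪Ḡx, x⟫ - 2⟪g x, x⟫ ≤ 2L‖x‖²`).
[cite: SandersVerhulstMurdock2007, Lemma 1.3.3 (Gronwall), linear case] -/
theorem norm_le_exp_mul_norm (G : E →L[ℝ] E) {g : ℝ → E →L[ℝ] E} (x : ℝ → E) {rlo L t : ℝ}
    (hrlo : 0 ≤ rlo) (hcoer : ∀ v : E, rlo * ‖v‖ ^ 2 ≤ ⟪G v, v⟫_ℝ)
    (hL : ∀ s ∈ Icc 0 t, ‖g s‖ ≤ L)
    (hx : ∀ s ∈ Icc 0 t, HasDerivAt x (-(G (x s) + g s (x s))) s) :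
    ∀ s ∈ Icc 0 t, ‖x s‖ ≤ Real.exp (L * s) * ‖x 0‖ := by
  intro s hs
  set φ : ℝ → ℝ := fun u => Real.exp (-(2 * L * u)) * ‖x u‖ ^ 2 with hφ
  have hφd : ∀ u ∈ Icc 0 t, HasDerivAt φ (Real.exp (-(2 * L * u)) * (-(2 * L)) * ‖x u‖ ^ 2 +
      Real.exp (-(2 * L * u)) * (2 * ⟪x u, -(G (x u) + g u (x u))⟫_ℝ)) u := by
    intro u hu
    have h1 : HasDerivAt (fun u => Real.exp (-(2 * L * u))) (Real.exp (-(2 * L * u)) * (-(2 * L))) u := by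
      have := (((hasDerivAt_id u).const_mul (2 * L)).neg).exp
      simpa using this
    exact h1.mul (hx u hu).norm_sq
  have hφ' : ∀ u ∈ interior (Icc 0 t), Real.exp (-(2 * L * u)) * (-(2 * L)) * ‖x u‖ ^ 2 +
      Real.exp (-(2 * L * u)) * (2 * ⟪x u, -(G (x u) + g u (x u))⟫_ℝ) ≤ 0 := by
    intro u hu
    have hu' : u ∈ Icc 0 t := interior_subset hu
    rw [inner_neg_right, inner_add_right]
    have hc : rlo * ‖x u‖ ^ 2 ≤ ⟪x u, G (x u)⟫_ℝ := (hcoer (x u)).trans_eq (real_inner_comm (x u) (G (x u)))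
    have hg' : ⟪x u, g u (x u)⟫_ℝ ≥ -(L * ‖x u‖ ^ 2) := by
      have h1 := abs_real_inner_le_norm (x u) (g u (x u))
      have h2 : ‖g u (x u)‖ ≤ L * ‖x u‖ := ((g u).le_opNorm _).trans
        (mul_le_mul_of_nonneg_right (hL u hu') (norm_nonneg _))
      have h3 := neg_abs_le ⟪x u, g u (x u)⟫_ℝ
      nlinarith [norm_nonneg (x u)]
    have hpos := Real.exp_pos (-(2 * L * u))
    nlinarith [hc, hpos, mul_nonneg hrlo (sq_nonneg ‖x u‖)]
  have hanti : AntitoneOn φ (Icc 0 t) :=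
    antitoneOn_of_hasDerivWithinAt_nonpos (convex_Icc 0 t)
      (fun u hu => (hφd u hu).continuousAt.continuousWithinAt)
      (fun u hu => (hφd u (interior_subset hu)).hasDerivWithinAt) hφ'
  have hφs : φ s ≤ φ 0 := hanti ⟨le_rfl, hs.1.trans hs.2⟩ hs hs.1
  have hφ0 : φ 0 = ‖x 0‖ ^ 2 := by simp [hφ]
  rw [hφ0] at hφs
  have hexp : Real.exp (-(2 * L * s)) * Real.exp (L * s) ^ 2 = 1 := by
    rw [← Real.exp_nat_mul, ← Real.exp_add]; norm_num; ring_nf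
  have hsq : ‖x s‖ ^ 2 ≤ (Real.exp (L * s) * ‖x 0‖) ^ 2 := by
    have hpos := Real.exp_pos (-(2 * L * s))
    have : Real.exp (-(2 * L * s)) * ‖x s‖ ^ 2 ≤ Real.exp (-(2 * L * s)) *
        (Real.exp (L * s) * ‖x 0‖) ^ 2 := by
      calc Real.exp (-(2 * L * s)) * ‖x s‖ ^ 2 = φ s := rfl
        _ ≤ ‖x 0‖ ^ 2 := hφs
        _ = Real.exp (-(2 * L * s)) * (Real.exp (L * s) * ‖x 0‖) ^ 2 := by
          rw [mul_pow, ← mul_assoc, hexp, one_mul]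
    exact le_of_mul_le_mul_left this hpos
  have hnn : 0 ≤ Real.exp (L * s) * ‖x 0‖ := mul_nonneg (Real.exp_pos _).le (norm_nonneg _)
  exact (pow_le_pow_iff_left₀ (norm_nonneg _) hnn two_ne_zero).1 hsq

/-- **First-order averaging on a finite horizon** (no a priori bound, no smallness): with the
Grönwall bound `M = e^{L t} ‖x(0)‖` of `norm_le_exp_mul_norm`,
`‖x(t) - exp(-tḠ) x(0)‖ ≤ e^{L t} ‖x(0)‖ (η (min(t, 1/r_lo) + P) + L P (1 + (2 Gn + L)/r_lo))` —
an `O(η t + L P)` error on horizons `L t = O(1)`.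
[cite: SandersVerhulstMurdock2007, Theorem 2.8.1 (the `O(ε)` estimate on the time scale `1/ε`)] -/
theorem norm_sub_exp_apply_le_of_horizon (G : E →L[ℝ] E) {g : ℝ → E →L[ℝ] E} (hg : Continuous g)
    (x : ℝ → E) {rlo Gn L η P t : ℝ} (hrlo : 0 < rlo) (hP : 0 < P) (hη : 0 ≤ η) (ht : 0 ≤ t)
    (hcoer : ∀ v : E, rlo * ‖v‖ ^ 2 ≤ ⟪G v, v⟫_ℝ) (hGn : ‖G‖ ≤ Gn)
    (hL : ∀ s ∈ Icc 0 t, ‖g s‖ ≤ L)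
    (hmean : ∀ n : ℕ, ((n : ℝ) + 1) * P ≤ t →
      ‖∫ s in ((n : ℝ) * P)..(((n : ℝ) + 1) * P), g s‖ ≤ η * P)
    (hx : ∀ s ∈ Icc 0 t, HasDerivAt x (-(G (x s) + g s (x s))) s) :
    ‖x t - exp (-(t • G)) (x 0)‖ ≤
      Real.exp (L * t) * ‖x 0‖ * (η * (min t (1 / rlo) + P) + L * P * (1 + (2 * Gn + L) / rlo)) := by
  have hL0 : 0 ≤ L := (norm_nonneg _).trans (hL 0 ⟨le_rfl, ht⟩)
  refine norm_sub_exp_apply_le G hg x hrlo hP hη ht hcoer hGn hL hmean hx fun s hs => ?_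
  refine (norm_le_exp_mul_norm G x hrlo.le hcoer hL hx s hs).trans ?_
  exact mul_le_mul_of_nonneg_right (Real.exp_le_exp.2 (mul_le_mul_of_nonneg_left hs.2 hL0))
    (norm_nonneg _)

/-! ## §6 Coordinates: the estimate on `ℝ^m` with matrices, entrywise bounds and a symmetric `Ḡ` -/

omit [CompleteSpace E] in
/-- A symmetric positive semidefinite operator whose quadratic form is `≤ r ‖v‖²` has operator norm
`≤ r` (Cauchy–Schwarz for the form `⟪T·, ·⟫`). [folklore] -/
private theorem norm_apply_le_of_inner_le (T : E →L[ℝ] E) {r : ℝ}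
    (hsymm : ∀ u v : E, ⟪T u, v⟫_ℝ = ⟪u, T v⟫_ℝ) (hpos : ∀ v : E, 0 ≤ ⟪T v, v⟫_ℝ)
    (hup : ∀ v : E, ⟪T v, v⟫_ℝ ≤ r * ‖v‖ ^ 2) (v : E) : ‖T v‖ ≤ r * ‖v‖ := by
  have hr : ∀ w : E, w ≠ 0 → 0 ≤ r := fun w hw => by
    have h := (hpos w).trans (hup w)
    have hw' : 0 < ‖w‖ ^ 2 := by positivity
    nlinarith
  set u : E := T v with hu
  by_cases hv : v = 0
  · simp [hu, hv]
  by_cases hu0 : u = 0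
  · rw [hu0, norm_zero]; exact mul_nonneg (hr v hv) (norm_nonneg _)
  -- expand 0 ≤ ⟪T(a u - b v), a u - b v⟫ with a = ‖v‖, b = ‖u‖
  have huv : ⟪T u, v⟫_ℝ = ‖u‖ ^ 2 := by rw [hsymm, ← hu, real_inner_self_eq_norm_sq]
  have hvu : ⟪T v, u⟫_ℝ = ‖u‖ ^ 2 := by rw [← hu, real_inner_self_eq_norm_sq]
  have key : ∀ a b : ℝ, 2 * a * b * ‖u‖ ^ 2 ≤ a ^ 2 * (r * ‖u‖ ^ 2) + b ^ 2 * (r * ‖v‖ ^ 2) := by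
    intro a b
    have h0 := hpos (a • u - b • v)
    rw [map_sub, map_smul, map_smul, inner_sub_left, inner_sub_right, inner_sub_right,
      real_inner_smul_left, real_inner_smul_left, real_inner_smul_right, real_inner_smul_right,
      real_inner_smul_left, real_inner_smul_right, real_inner_smul_left, real_inner_smul_right,
      huv, hvu] at h0
    nlinarith [hup u, hup v, sq_nonneg a, sq_nonneg b]
  have h := key ‖v‖ ‖u‖
  have hupos : 0 < ‖u‖ := norm_pos_iff.2 hu0
  have hvpos : 0 < ‖v‖ := norm_pos_iff.2 hv
  nlinarith [mul_pos hupos hvpos, mul_pos (mul_pos hupos hupos) hvpos]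

omit [CompleteSpace E] in
/-- Operator-norm version of `norm_apply_le_of_inner_le`. [folklore] -/
private theorem opNorm_le_of_inner_le (T : E →L[ℝ] E) {r : ℝ}
    (hsymm : ∀ u v : E, ⟪T u, v⟫_ℝ = ⟪u, T v⟫_ℝ) (hpos : ∀ v : E, 0 ≤ ⟪T v, v⟫_ℝ)
    (hup : ∀ v : E, ⟪T v, v⟫_ℝ ≤ r * ‖v‖ ^ 2) (hr : 0 ≤ r) : ‖T‖ ≤ r :=
  ContinuousLinearMap.opNorm_le_bound _ hr (norm_apply_le_of_inner_le T hsymm hpos hup)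

section Coordinates

open Matrix

variable {m : ℕ}

/-- The operator on `EuclideanSpace ℝ (Fin m)` of a matrix `A` acts by `A *ᵥ ·` on coordinates.
[folklore] -/
private theorem toEuclideanCLM_apply_toLp (A : Matrix (Fin m) (Fin m) ℝ) (w : Fin m → ℝ) :
    LinearMap.toContinuousLinearMap (Matrix.toEuclideanLin A) (WithLp.toLp 2 w) =
      WithLp.toLp 2 (A.mulVec w) := rfl

/-- Coordinates of the matrix action. [folklore] -/
private theorem toEuclideanCLM_apply_apply (A : Matrix (Fin m) (Fin m) ℝ) (v : EuclideanSpace ℝ (Fin m))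
    (i : Fin m) :
    (LinearMap.toContinuousLinearMap (Matrix.toEuclideanLin A) v) i = ∑ j, A i j * v j := rfl

/-- The quadratic form in coordinates: `⟪A v, v⟫ = Σᵢ Σⱼ vᵢ Aᵢⱼ vⱼ`. [folklore] -/
private theorem inner_toEuclideanCLM_apply (A : Matrix (Fin m) (Fin m) ℝ) (v : EuclideanSpace ℝ (Fin m)) :
    ⟪LinearMap.toContinuousLinearMap (Matrix.toEuclideanLin A) v, v⟫_ℝ = ∑ i, ∑ j, v i * A i j * v j := by
  rw [EuclideanSpace.inner_eq_star_dotProduct, star_trivial]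
  change ∑ i, v i * (∑ j, A i j * v j) = _
  simp only [Finset.mul_sum]
  exact Finset.sum_congr rfl fun i _ => Finset.sum_congr rfl fun j _ => by ring

/-- Symmetry of the matrix action from `A.IsSymm`. [folklore] -/
private theorem inner_toEuclideanCLM_symm {A : Matrix (Fin m) (Fin m) ℝ} (hA : A.IsSymm)
    (u v : EuclideanSpace ℝ (Fin m)) :
    ⟪LinearMap.toContinuousLinearMap (Matrix.toEuclideanLin A) u, v⟫_ℝ =
      ⟪u, LinearMap.toContinuousLinearMap (Matrix.toEuclideanLin A) v⟫_ℝ := by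
  rw [EuclideanSpace.inner_eq_star_dotProduct, EuclideanSpace.inner_eq_star_dotProduct,
    star_trivial, star_trivial]
  change WithLp.ofLp v ⬝ᵥ (A *ᵥ WithLp.ofLp u) = (A *ᵥ WithLp.ofLp v) ⬝ᵥ WithLp.ofLp u
  rw [dotProduct_mulVec, ← mulVec_transpose, hA.eq]

/-- **Entrywise bound ⇒ operator bound**: `|Aᵢⱼ| ≤ a` for all `i, j` gives `‖A v‖ ≤ m a ‖v‖` on
`EuclideanSpace ℝ (Fin m)`. [folklore] -/
private theorem norm_toEuclideanCLM_apply_le {A : Matrix (Fin m) (Fin m) ℝ} {a : ℝ}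
    (hA : ∀ i j, |A i j| ≤ a) (v : EuclideanSpace ℝ (Fin m)) :
    ‖LinearMap.toContinuousLinearMap (Matrix.toEuclideanLin A) v‖ ≤ m * a * ‖v‖ := by
  have hv2 : ‖v‖ ^ 2 = ∑ j, v j ^ 2 := EuclideanSpace.real_norm_sq_eq v
  -- each coordinate: (Σⱼ Aᵢⱼ vⱼ)² ≤ a² m ‖v‖²
  have hrow : ∀ i, (∑ j, A i j * v j) ^ 2 ≤ a ^ 2 * (m * ‖v‖ ^ 2) := by
    intro i
    have h1 : |∑ j, A i j * v j| ≤ ∑ j, a * |v j| := (Finset.abs_sum_le_sum_abs _ _).trans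
      (Finset.sum_le_sum fun j _ => by rw [abs_mul]; exact mul_le_mul_of_nonneg_right (hA i j) (abs_nonneg _))
    have h2 : (∑ j, a * |v j|) ^ 2 = a ^ 2 * (∑ j : Fin m, |v j|) ^ 2 := by
      rw [← Finset.mul_sum]; ring
    have h3 := Finset.sum_mul_sq_le_sq_mul_sq (Finset.univ : Finset (Fin m)) (fun _ => (1 : ℝ))
      (fun j => |v j|)
    simp only [one_mul, one_pow, Finset.sum_const, Finset.card_univ, Fintype.card_fin, nsmul_eq_mul,
      mul_one, sq_abs] at h3
    have h0 : 0 ≤ |∑ j, A i j * v j| := abs_nonneg _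
    calc (∑ j, A i j * v j) ^ 2 = |∑ j, A i j * v j| ^ 2 := (sq_abs _).symm
      _ ≤ (∑ j, a * |v j|) ^ 2 := pow_le_pow_left₀ h0 h1 2
      _ ≤ a ^ 2 * (m * ‖v‖ ^ 2) := by rw [h2, hv2]; exact mul_le_mul_of_nonneg_left h3 (sq_nonneg _)
  have hsq : ‖LinearMap.toContinuousLinearMap (Matrix.toEuclideanLin A) v‖ ^ 2 ≤ (m * a * ‖v‖) ^ 2 := by
    rw [EuclideanSpace.real_norm_sq_eq]
    calc ∑ i, (LinearMap.toContinuousLinearMap (Matrix.toEuclideanLin A) v) i ^ 2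
        = ∑ i, (∑ j, A i j * v j) ^ 2 := by rfl
      _ ≤ ∑ _i : Fin m, a ^ 2 * (m * ‖v‖ ^ 2) := Finset.sum_le_sum fun i _ => hrow i
      _ = (m * a * ‖v‖) ^ 2 := by simp; ring
  have hY : 0 ≤ (m : ℝ) * a * ‖v‖ := by
    rcases Nat.eq_zero_or_pos m with hm | hm
    · simp [hm]
    · have ha : 0 ≤ a := (abs_nonneg _).trans (hA ⟨0, hm⟩ ⟨0, hm⟩)
      positivity
  exact (pow_le_pow_iff_left₀ (norm_nonneg _) hY two_ne_zero).1 hsq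

/-- The matrix action depends continuously (indeed linearly) on the matrix. [folklore] -/
private theorem continuous_toEuclideanCLM :
    Continuous fun A : Matrix (Fin m) (Fin m) ℝ =>
      LinearMap.toContinuousLinearMap (Matrix.toEuclideanLin A) :=
  ((LinearMap.toContinuousLinearMap (𝕜 := ℝ) (E := EuclideanSpace ℝ (Fin m))
      (F' := EuclideanSpace ℝ (Fin m))).toLinearMap ∘ₗ
    (Matrix.toEuclideanLin (𝕜 := ℝ) (m := Fin m) (n := Fin m)).toLinearMap).continuous_of_finiteDimensional

/-- Coordinates of the window integral of the matrix action: `((∫ A(s) ds) v)ᵢ = Σⱼ (∫ Aᵢⱼ) vⱼ`.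
[folklore] -/
private theorem integral_toEuclideanCLM_apply_apply {g : ℝ → Matrix (Fin m) (Fin m) ℝ} (hg : Continuous g)
    (a b : ℝ) (v : EuclideanSpace ℝ (Fin m)) (i : Fin m) :
    ((∫ s in a..b, LinearMap.toContinuousLinearMap (Matrix.toEuclideanLin (g s))) v) i =
      ∑ j, (∫ s in a..b, g s i j) * v j := by
  have hc : Continuous fun s => LinearMap.toContinuousLinearMap (Matrix.toEuclideanLin (g s)) :=
    continuous_toEuclideanCLM.comp hg
  rw [ContinuousLinearMap.intervalIntegral_apply (hc.intervalIntegrable _ _) v]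
  have hci : Continuous fun s => LinearMap.toContinuousLinearMap (Matrix.toEuclideanLin (g s)) v :=
    hc.clm_apply continuous_const
  have h1 : ((∫ s in a..b, LinearMap.toContinuousLinearMap (Matrix.toEuclideanLin (g s)) v) : EuclideanSpace ℝ (Fin m)) i
      = (EuclideanSpace.proj i : EuclideanSpace ℝ (Fin m) →L[ℝ] ℝ)
          (∫ s in a..b, LinearMap.toContinuousLinearMap (Matrix.toEuclideanLin (g s)) v) := rfl
  rw [h1, ← ContinuousLinearMap.intervalIntegral_comp_comm _ (hci.intervalIntegrable _ _)]
  have h2 : (fun s => (EuclideanSpace.proj i : EuclideanSpace ℝ (Fin m) →L[ℝ] ℝ)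
      (LinearMap.toContinuousLinearMap (Matrix.toEuclideanLin (g s)) v)) =
      fun s => ∑ j, g s i j * v j := by
    funext s; rfl
  rw [h2, intervalIntegral.integral_finsetSum (fun j _ => ?_)]
  · exact Finset.sum_congr rfl fun j _ => intervalIntegral.integral_mul_const _ _
  · have hgij : Continuous fun s => g s i j :=
      (continuous_apply j).comp ((continuous_apply i).comp hg)
    exact (hgij.mul continuous_const).intervalIntegrable _ _

end Coordinates


section CoordinatesMain

open Matrix

variable {m : ℕ}

/-- The arithmetic of the constants in the coordinate form. [folklore] -/
private theorem coord_bound_le {κ rlo rbar e P t : ℝ} (m : ℕ) (hκ : 1 ≤ κ) (hrlo : 0 < rlo)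
    (hκr : rbar ≤ κ * rlo) (hrbar : 0 ≤ rbar) (he0 : 0 ≤ e) (he1 : e ≤ 1) (hP : 0 < P)
    (ht : 0 ≤ t) :
    (m * e * rbar) * (min t (1 / rlo) + P) + (m * rbar) * P * (1 + (2 * rbar + m * rbar) / rlo) ≤
      m * (2 + (m + 2) * κ) * (e * min 1 (rbar * t) + rbar * P) := by
  have hm : (0 : ℝ) ≤ m := Nat.cast_nonneg m
  have hratio : rbar / rlo ≤ κ := (div_le_iff₀ hrlo).2 hκr
  -- (1) rbar * min t (1/rlo) ≤ κ * min 1 (rbar t)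
  have h1 : rbar * min t (1 / rlo) ≤ κ * min 1 (rbar * t) := by
    have hrt : 0 ≤ rbar * t := mul_nonneg hrbar ht
    rcases le_total t (1 / rlo) with h | h
    · rw [min_eq_left h]
      rcases le_total (rbar * t) 1 with h' | h'
      · rw [min_eq_right h']; nlinarith
      · rw [min_eq_left h']
        have : rbar * t ≤ rbar * (1 / rlo) := mul_le_mul_of_nonneg_left h hrbar
        rw [mul_one_div] at this
        linarith
    · rw [min_eq_right h]
      rcases le_total (rbar * t) 1 with h' | h'
      · rw [min_eq_right h']
        have : rbar * (1 / rlo) ≤ rbar * t := mul_le_mul_of_nonneg_left h hrbar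
        rw [mul_one_div] at this
        nlinarith
      · rw [min_eq_left h']; rw [mul_one_div]; linarith
  -- (2) (2 rbar + m rbar)/rlo ≤ (m+2) κ
  have h2 : (2 * rbar + m * rbar) / rlo ≤ (m + 2) * κ := by
    rw [show (2 * rbar + m * rbar) / rlo = (m + 2) * (rbar / rlo) by ring]
    exact mul_le_mul_of_nonneg_left hratio (by positivity)
  have hmin0 : 0 ≤ min 1 (rbar * t) := le_min zero_le_one (mul_nonneg hrbar ht)
  have hrP : 0 ≤ rbar * P := mul_nonneg hrbar hP.le
  -- assemble
  have hA : (m * e * rbar) * (min t (1 / rlo) + P) ≤ m * κ * (e * min 1 (rbar * t)) + m * (rbar * P) := by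
    have : (m * e * rbar) * (min t (1 / rlo) + P) = m * e * (rbar * min t (1 / rlo)) + m * e * (rbar * P) := by
      ring
    rw [this]
    have hme : 0 ≤ (m : ℝ) * e := mul_nonneg hm he0
    nlinarith [mul_le_mul_of_nonneg_left h1 hme, mul_le_mul_of_nonneg_left hrP hm]
  have hB : (m * rbar) * P * (1 + (2 * rbar + m * rbar) / rlo) ≤ m * (rbar * P) * (1 + (m + 2) * κ) := by
    have : (m * rbar) * P * (1 + (2 * rbar + m * rbar) / rlo) = m * (rbar * P) * (1 + (2 * rbar + m * rbar) / rlo) := by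
      ring
    rw [this]
    exact mul_le_mul_of_nonneg_left (by linarith) (mul_nonneg hm hrP)
  have hκ0 : 0 ≤ κ := zero_le_one.trans hκ
  have hX : 0 ≤ e * min 1 (rbar * t) := mul_nonneg he0 hmin0
  have key : m * κ * (e * min 1 (rbar * t)) ≤ m * (2 + (m + 2) * κ) * (e * min 1 (rbar * t)) :=
    mul_le_mul_of_nonneg_right (mul_le_mul_of_nonneg_left (by nlinarith) hm) hX
  calc (m * e * rbar) * (min t (1 / rlo) + P) + (m * rbar) * P * (1 + (2 * rbar + m * rbar) / rlo)
      ≤ (m * κ * (e * min 1 (rbar * t)) + m * (rbar * P)) + m * (rbar * P) * (1 + (m + 2) * κ) :=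
        add_le_add hA hB
    _ = m * κ * (e * min 1 (rbar * t)) + m * (2 + (m + 2) * κ) * (rbar * P) := by ring
    _ ≤ m * (2 + (m + 2) * κ) * (e * min 1 (rbar * t)) + m * (2 + (m + 2) * κ) * (rbar * P) :=
        add_le_add key le_rfl
    _ = m * (2 + (m + 2) * κ) * (e * min 1 (rbar * t) + rbar * P) := by ring

/-- **THE COORDINATE FORM (relative to an a priori bound).** `x' = -(Ḡ + g(t)) x` on `ℝ^m`
(`t ≥ 0`) with `Ḡ` symmetric, `r_lo Σvᵢ² ≤ vᵀḠv ≤ r̄ Σvᵢ²`, `r̄ ≤ κ r_lo`; `g` continuous with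
entries `|gᵢⱼ(t)| ≤ r̄` and window means `|∫_{nP}^{(n+1)P} gᵢⱼ| ≤ e r̄ P` (`0 ≤ e ≤ 1`, `P > 0`);
`z' = -Ḡ z` with `z(0) = x(0)`; and the A PRIORI BOUND `Σ xᵢ(t)² ≤ B² Σ xᵢ(0)²`. Then for all
`t ≥ 0`: `Σᵢ (xᵢ(t) - zᵢ(t))² ≤ (m (2 + (m+2) κ) B (e·min(1, r̄ t) + r̄ P))² Σᵢ xᵢ(0)²`.
(The a priori bound cannot be dropped: see the two counterexamples in the module docstring.)
[cite: SandersVerhulstMurdock2007, Theorem 2.8.1 with Lemma 2.8.2, and Theorem 5.5.1; linear case] -/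
theorem sum_sq_sub_le_of_apriori (m : ℕ) (κ : ℝ) (hκ : 1 ≤ κ)
    (Gbar : Matrix (Fin m) (Fin m) ℝ) (g : ℝ → Matrix (Fin m) (Fin m) ℝ) (x z : ℝ → Fin m → ℝ)
    (rlo rbar P e B : ℝ) (hrlo : 0 < rlo) (hκr : rbar ≤ κ * rlo) (hP : 0 < P)
    (he0 : 0 ≤ e) (he1 : e ≤ 1) (hB0 : 0 ≤ B) (hsymm : Gbar.IsSymm)
    (hlow : ∀ v : Fin m → ℝ, rlo * ∑ i, v i ^ 2 ≤ ∑ i, ∑ j, v i * Gbar i j * v j)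
    (hup : ∀ v : Fin m → ℝ, ∑ i, ∑ j, v i * Gbar i j * v j ≤ rbar * ∑ i, v i ^ 2)
    (hg : Continuous g) (hgb : ∀ t, 0 ≤ t → ∀ i j, |g t i j| ≤ rbar)
    (hmean : ∀ n : ℕ, ∀ i j, |∫ t in ((n : ℝ) * P)..(((n : ℝ) + 1) * P), g t i j| ≤ e * rbar * P)
    (hx : ∀ t, 0 ≤ t → HasDerivAt x (-((Gbar + g t).mulVec (x t))) t)
    (hz : ∀ t, 0 ≤ t → HasDerivAt z (-(Gbar.mulVec (z t))) t) (hz0 : z 0 = x 0)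
    (hB : ∀ t, 0 ≤ t → ∑ i, x t i ^ 2 ≤ B ^ 2 * ∑ i, x 0 i ^ 2) {t : ℝ} (ht : 0 ≤ t) :
    ∑ i, (x t i - z t i) ^ 2 ≤
      (m * (2 + (m + 2) * κ) * B * (e * min 1 (rbar * t) + rbar * P)) ^ 2 * ∑ i, x 0 i ^ 2 := by
  rcases Nat.eq_zero_or_pos m with hm | hm
  · subst hm; simp
  have hrbar : 0 ≤ rbar := (abs_nonneg _).trans (hgb 0 le_rfl ⟨0, hm⟩ ⟨0, hm⟩)
  -- move to `EuclideanSpace ℝ (Fin m)`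
  set G : EuclideanSpace ℝ (Fin m) →L[ℝ] EuclideanSpace ℝ (Fin m) :=
    LinearMap.toContinuousLinearMap (Matrix.toEuclideanLin Gbar) with hG
  set gE : ℝ → EuclideanSpace ℝ (Fin m) →L[ℝ] EuclideanSpace ℝ (Fin m) :=
    fun s => LinearMap.toContinuousLinearMap (Matrix.toEuclideanLin (g s)) with hgE
  set xE : ℝ → EuclideanSpace ℝ (Fin m) := fun s => WithLp.toLp 2 (x s) with hxE
  set zE : ℝ → EuclideanSpace ℝ (Fin m) := fun s => WithLp.toLp 2 (z s) with hzE
  have hgEc : Continuous gE := continuous_toEuclideanCLM.comp hg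
  -- coercivity, symmetry, norm of Ḡ
  have hcoer : ∀ v : EuclideanSpace ℝ (Fin m), rlo * ‖v‖ ^ 2 ≤ ⟪G v, v⟫_ℝ := fun v => by
    rw [hG, inner_toEuclideanCLM_apply, EuclideanSpace.real_norm_sq_eq]; exact hlow _
  have hpos : ∀ v : EuclideanSpace ℝ (Fin m), 0 ≤ ⟪G v, v⟫_ℝ := fun v =>
    (mul_nonneg hrlo.le (sq_nonneg ‖v‖)).trans (hcoer v)
  have hup' : ∀ v : EuclideanSpace ℝ (Fin m), ⟪G v, v⟫_ℝ ≤ rbar * ‖v‖ ^ 2 := fun v => by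
    rw [hG, inner_toEuclideanCLM_apply, EuclideanSpace.real_norm_sq_eq]; exact hup _
  have hGn : ‖G‖ ≤ rbar :=
    opNorm_le_of_inner_le G (inner_toEuclideanCLM_symm hsymm) hpos hup' hrbar
  -- pointwise bound on g
  have hL : ∀ s ∈ Icc 0 t, ‖gE s‖ ≤ m * rbar := fun s hs =>
    ContinuousLinearMap.opNorm_le_bound _ (by positivity)
      (norm_toEuclideanCLM_apply_le (hgb s hs.1))
  -- window means
  have hmean' : ∀ n : ℕ, ((n : ℝ) + 1) * P ≤ t →
      ‖∫ s in ((n : ℝ) * P)..(((n : ℝ) + 1) * P), gE s‖ ≤ (m * e * rbar) * P := by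
    intro n _
    refine ContinuousLinearMap.opNorm_le_bound _ (by positivity) fun v => ?_
    set A : Matrix (Fin m) (Fin m) ℝ := fun i j => ∫ s in ((n : ℝ) * P)..(((n : ℝ) + 1) * P), g s i j
      with hA
    have hAv : (∫ s in ((n : ℝ) * P)..(((n : ℝ) + 1) * P), gE s) v =
        LinearMap.toContinuousLinearMap (Matrix.toEuclideanLin A) v := by
      refine PiLp.ext fun i => ?_
      rw [hgE, integral_toEuclideanCLM_apply_apply hg, toEuclideanCLM_apply_apply]
    rw [hAv]
    calc ‖LinearMap.toContinuousLinearMap (Matrix.toEuclideanLin A) v‖ ≤ m * (e * rbar * P) * ‖v‖ :=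
          norm_toEuclideanCLM_apply_le (fun i j => hmean n i j) v
      _ = m * e * rbar * P * ‖v‖ := by ring
  -- the solutions
  have hxE' : ∀ s ∈ Icc 0 t, HasDerivAt xE (-(G (xE s) + gE s (xE s))) s := by
    intro s hs
    have h := (PiLp.continuousLinearEquiv 2 ℝ (fun _ : Fin m => ℝ)).symm.toContinuousLinearMap
      |>.hasFDerivAt.comp_hasDerivAt s (hx s hs.1)
    have heq : (PiLp.continuousLinearEquiv 2 ℝ (fun _ : Fin m => ℝ)).symm.toContinuousLinearMap
        (-((Gbar + g s).mulVec (x s))) = -(G (xE s) + gE s (xE s)) := by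
      rw [hG, hgE, hxE]
      simp only [toEuclideanCLM_apply_toLp, Matrix.add_mulVec]
      rfl
    rw [heq] at h
    exact h
  have hzE' : ∀ s ∈ Icc 0 t, HasDerivAt zE (-(G (zE s))) s := by
    intro s hs
    have h := (PiLp.continuousLinearEquiv 2 ℝ (fun _ : Fin m => ℝ)).symm.toContinuousLinearMap
      |>.hasFDerivAt.comp_hasDerivAt s (hz s hs.1)
    have heq : (PiLp.continuousLinearEquiv 2 ℝ (fun _ : Fin m => ℝ)).symm.toContinuousLinearMap
        (-(Gbar.mulVec (z s))) = -(G (zE s)) := by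
      rw [hG, hzE]
      simp only [toEuclideanCLM_apply_toLp]
      rfl
    rw [heq] at h
    exact h
  have hzE0 : zE 0 = xE 0 := by simp [hzE, hxE, hz0]
  -- the a priori bound
  have hnorm : ∀ s, ‖xE s‖ ^ 2 = ∑ i, x s i ^ 2 := fun s => EuclideanSpace.real_norm_sq_eq _
  have hM : ∀ s ∈ Icc 0 t, ‖xE s‖ ≤ B * ‖xE 0‖ := by
    intro s hs
    have h := hB s hs.1
    rw [← hnorm, ← hnorm, ← mul_pow] at h
    exact (pow_le_pow_iff_left₀ (norm_nonneg _) (mul_nonneg hB0 (norm_nonneg _)) two_ne_zero).1 h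
  -- the estimate in `E`
  have hest := norm_sub_le_of_apriori G hgEc xE zE hrlo hP (by positivity) ht hcoer hGn hL hmean'
    hxE' hzE' hzE0 hM
  -- back to coordinates
  have hdiff : ‖xE t - zE t‖ ^ 2 = ∑ i, (x t i - z t i) ^ 2 := by
    rw [EuclideanSpace.real_norm_sq_eq]; rfl
  have hcb := coord_bound_le m hκ hrlo hκr hrbar he0 he1 hP ht
  have hfin : ‖xE t - zE t‖ ≤
      m * (2 + (m + 2) * κ) * B * (e * min 1 (rbar * t) + rbar * P) * ‖xE 0‖ := by
    refine hest.trans ?_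
    have hB' : 0 ≤ B * ‖xE 0‖ := mul_nonneg hB0 (norm_nonneg _)
    calc B * ‖xE 0‖ * (m * e * rbar * (min t (1 / rlo) + P) +
          m * rbar * P * (1 + (2 * rbar + m * rbar) / rlo))
        ≤ B * ‖xE 0‖ * (m * (2 + (m + 2) * κ) * (e * min 1 (rbar * t) + rbar * P)) :=
          mul_le_mul_of_nonneg_left hcb hB'
      _ = m * (2 + (m + 2) * κ) * B * (e * min 1 (rbar * t) + rbar * P) * ‖xE 0‖ := by ring
  rw [← hdiff, ← hnorm 0, ← mul_pow]
  exact pow_le_pow_left₀ (norm_nonneg _) hfin 2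

end CoordinatesMain

/-! ## §7 (amendment 1) The comparison flow as the MATRIX exponential `exp(-tḠ) *ᵥ x(0)` -/

section MatrixExp

open Matrix

variable {m : ℕ}

set_option backward.isDefEq.respectTransparency false in
/-- `t ↦ exp(-tA) *ᵥ v` solves `z' = -A *ᵥ z` (the matrix exponential `NormedSpace.exp` in the
topological ring of matrices; the norm used in the proof — the `ℓ^∞` operator norm,
`Matrix.Norms.Operator` — is hidden, as in Mathlib's `Matrix.exp_add_of_commute`).
[cite: Hale1980, Ch. III §1, Theorem 1.1 (homogeneous constant-coefficient case)] -/
theorem hasDerivAt_exp_neg_smul_mulVec (A : Matrix (Fin m) (Fin m) ℝ) (v : Fin m → ℝ) (t : ℝ) :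
    HasDerivAt (fun u : ℝ => (NormedSpace.exp (-(u • A))).mulVec v)
      (-(A.mulVec ((NormedSpace.exp (-(t • A))).mulVec v))) t := by
  open scoped Matrix.Norms.Operator in
  -- the linear map `M ↦ M *ᵥ v`, continuous for the operator norm (finite dimension)
  have key : HasDerivAt (fun u : ℝ => (NormedSpace.exp (u • (-A))).mulVec v)
      (((-A) * NormedSpace.exp (t • (-A))).mulVec v) t := by
    let Lv : Matrix (Fin m) (Fin m) ℝ →ₗ[ℝ] (Fin m → ℝ) :=
      { toFun := fun M => M.mulVec v
        map_add' := fun M N => add_mulVec M N v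
        map_smul' := fun c M => smul_mulVec c M v }
    have hL := (LinearMap.toContinuousLinearMap Lv).hasFDerivAt (x := NormedSpace.exp (t • (-A)))
    have h := hL.comp_hasDerivAt t (hasDerivAt_exp_smul_const' (𝕂 := ℝ) (-A) t)
    exact h
  have hfun : (fun u : ℝ => (NormedSpace.exp (u • (-A))).mulVec v) =
      fun u : ℝ => (NormedSpace.exp (-(u • A))).mulVec v := by
    funext u; rw [smul_neg]
  rw [hfun, smul_neg, Matrix.neg_mul, Matrix.neg_mulVec, ← Matrix.mulVec_mulVec] at key
  exact key

/-- **THE COORDINATE FORM against the matrix exponential** — exactly the text of the K1L plan's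
`DecayRelativeAveragingB` (STUB-IDEAS `stub_cellLawV`, V5, with the a priori bound `hB`), with the
explicit constant `C = m (2 + (m+2) κ)`: for `x' = -(Ḡ + g(t)) x` on `ℝ^m` as in
`sum_sq_sub_le_of_apriori`,
`Σᵢ (xᵢ(t) - (exp(-tḠ) x(0))ᵢ)² ≤ (C B (e·min(1, r̄t) + r̄P))² Σᵢ xᵢ(0)²` for all `t ≥ 0`.
(The hypotheses `rlo ≤ rbar` and `rbar * P ≤ 1` are carried for the interface only; they are not
used.) [cite: SandersVerhulstMurdock2007, Theorem 2.8.1 with Lemma 2.8.2, and Theorem 5.5.1;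
linear case] -/
theorem sum_sq_sub_exp_mulVec_le_of_apriori :
    ∀ (m : ℕ) (κ : ℝ), 1 ≤ κ → ∃ C : ℝ, 0 ≤ C ∧
    ∀ (Gbar : Matrix (Fin m) (Fin m) ℝ) (g : ℝ → Matrix (Fin m) (Fin m) ℝ) (x : ℝ → Fin m → ℝ)
      (rlo rbar P e B : ℝ),
      0 < rlo → rlo ≤ rbar → rbar ≤ κ * rlo → 0 < P → rbar * P ≤ 1 → 0 ≤ e → e ≤ 1 → 0 ≤ B →
      Gbar.IsSymm →
      (∀ v : Fin m → ℝ, rlo * ∑ i, v i ^ 2 ≤ ∑ i, ∑ j, v i * Gbar i j * v j) →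
      (∀ v : Fin m → ℝ, ∑ i, ∑ j, v i * Gbar i j * v j ≤ rbar * ∑ i, v i ^ 2) →
      Continuous g → (∀ t, 0 ≤ t → ∀ i j, |g t i j| ≤ rbar) →
      (∀ n : ℕ, ∀ i j, |∫ t in ((n : ℝ) * P)..(((n : ℝ) + 1) * P), g t i j| ≤ e * rbar * P) →
      (∀ t, 0 ≤ t → HasDerivAt x (-((Gbar + g t).mulVec (x t))) t) →
      (∀ t, 0 ≤ t → ∑ i, (x t i) ^ 2 ≤ B ^ 2 * ∑ i, (x 0 i) ^ 2) →
      ∀ t, 0 ≤ t →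
        ∑ i, (x t i - (NormedSpace.exp (-(t • Gbar))).mulVec (x 0) i) ^ 2 ≤
          (C * B * (e * min 1 (rbar * t) + rbar * P)) ^ 2 * ∑ i, (x 0) i ^ 2 := by
  intro m κ hκ
  refine ⟨m * (2 + (m + 2) * κ), by positivity, ?_⟩
  intro Gbar g x rlo rbar P e B hrlo _ hκr hP _ he0 he1 hB0 hsymm hlow hup hg hgb hmean hx hB t ht
  set z : ℝ → Fin m → ℝ := fun u => (NormedSpace.exp (-(u • Gbar))).mulVec (x 0) with hz
  have hzd : ∀ u, 0 ≤ u → HasDerivAt z (-(Gbar.mulVec (z u))) u := fun u _ =>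
    hasDerivAt_exp_neg_smul_mulVec Gbar (x 0) u
  have hz0 : z 0 = x 0 := by simp [hz]
  have h := sum_sq_sub_le_of_apriori m κ hκ Gbar g x z rlo rbar P e B hrlo hκr hP he0 he1 hB0 hsymm
    hlow hup hg hgb hmean hx hzd hz0 hB ht
  simpa only [hz, mul_assoc] using h

end MatrixExp

end Literature.Analysis.ODE.PeriodicAveraging

end
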